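import Mathlib
import Summits.Ventures.HodgeRepro.Tier4.Target
import Summits.Ventures.HodgeRepro.Tier4.Line3.KMDatum
import Summits.Ventures.HodgeRepro.Tier4.Line3.KMDatumS
import Summits.Ventures.HodgeRepro.Tier4.Line3.Defs
import Summits.Ventures.HodgeRepro.Tier4.Line3.DatumOrthVanishing

/-!
# Tier4/Line3/OriginRigidity — `U(2,1)`-equivariance fixes the datum at the origin up to one scalar

Blind re-derivation cell `pub-hodge-repro`, Tier 4 «PROVE THE STEP», LINE L3, seat t4-x2 (g4, reserve wall-breaker),
cut C-L3-HKRAY (plan-3 g4, bus S14230 / S14274): the first half of finding (F6) of bus S14325 (RIGIDITY) in the kernel.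

For a datum `Φ : KMDatumS` with the equivariance of `ThetaData.equiv`, the coefficient matrices at the origin are
`A_k(0) = c · E_{k,2}` for ONE scalar `c ∈ ℂ`, i.e. `y^* A_k(0) y = c · conj(y_k) y₂` — the `ȳ_k y₂ e^{−π|y|²}` of the
docstring of `KMDatumS`.  Proof: the stabiliser `K = U(2) × U(1)` of the origin acts on the ball by `z ↦ e^{−iθ} U z`
(Jacobian `e^{−iθ} U`, `pd_actM_eq`); the three elements `diag(1, 1, i)`, `diag(1, −1, 1)` and the swap of the first two
coordinates give, after polarisation (`matrix_eq_of_form_eq`), `A_k(0) = i · D^* A_k(0) D` (kills every entry outside the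
column `2`), `A_k(0)_{m,2} = 0` for `m ≠ k`, and `A_0(0)_{0,2} = A_1(0)_{1,2}`.

Nothing here says anything about the status of the Hodge conjecture for CM abelian varieties, which is NOT proved
(HC_CM is NOT proved by anyone in this repository).
-/

set_option autoImplicit false

noncomputable section

namespace Summit.Ventures.HodgeRepro.Tier4.Line3

open Summit.Ventures.HodgeRepro.Tier4
open Matrix
open scoped ComplexConjugate

/-! ## 1. Polarisation: a sesquilinear form on `ℂ³` is determined by its values on the diagonal -/

/-- A matrix whose sesquilinear form vanishes on the diagonal is zero (the nine test vectors
`e_i`, `e_i + e_j`, `e_i + i e_j`). -/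
theorem matrix_eq_zero_of_form_eq_zero {D : Matrix (Fin 3) (Fin 3) ℂ}
    (hq : ∀ y : Fin 3 → ℂ, star y ⬝ᵥ (D *ᵥ y) = 0) : D = 0 := by
  have e0 := hq ![1, 0, 0]
  have e1 := hq ![0, 1, 0]
  have e2 := hq ![0, 0, 1]
  have e01 := hq ![1, 1, 0]
  have e01i := hq ![1, Complex.I, 0]
  have e02 := hq ![1, 0, 1]
  have e02i := hq ![1, 0, Complex.I]
  have e12 := hq ![0, 1, 1]
  have e12i := hq ![0, 1, Complex.I]
  simp only [dotProduct, Matrix.mulVec, Fin.sum_univ_three, Pi.star_apply, Matrix.cons_val_zero,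
    Matrix.cons_val_one, Matrix.head_cons, Matrix.cons_val_two, Matrix.tail_cons, Complex.star_def, map_one,
    map_zero, Complex.conj_I, mul_one, mul_zero, zero_mul, one_mul, add_zero, zero_add] at e0 e1 e2 e01 e01i e02 e02i e12 e12i
  have hI : Complex.I ≠ 0 := Complex.I_ne_zero
  ext i j
  fin_cases i <;> fin_cases j <;> simp only [Matrix.zero_apply, Fin.zero_eta, Fin.mk_one, Fin.reduceFinMk]
  · linear_combination e0
  · have hS : D 0 1 + D 1 0 = 0 := by linear_combination e01 - e0 - e1
    have hT : Complex.I * (D 0 1 - D 1 0) = 0 := by linear_combination e01i - e0 + Complex.I ^ 2 * e1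
    have hT' : D 0 1 - D 1 0 = 0 := (mul_eq_zero.1 hT).resolve_left hI
    linear_combination (1 / 2 : ℂ) * hS + (1 / 2 : ℂ) * hT'
  · have hS : D 0 2 + D 2 0 = 0 := by linear_combination e02 - e0 - e2
    have hT : Complex.I * (D 0 2 - D 2 0) = 0 := by linear_combination e02i - e0 + Complex.I ^ 2 * e2
    have hT' : D 0 2 - D 2 0 = 0 := (mul_eq_zero.1 hT).resolve_left hI
    linear_combination (1 / 2 : ℂ) * hS + (1 / 2 : ℂ) * hT'
  · have hS : D 0 1 + D 1 0 = 0 := by linear_combination e01 - e0 - e1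
    have hT : Complex.I * (D 0 1 - D 1 0) = 0 := by linear_combination e01i - e0 + Complex.I ^ 2 * e1
    have hT' : D 0 1 - D 1 0 = 0 := (mul_eq_zero.1 hT).resolve_left hI
    linear_combination (1 / 2 : ℂ) * hS - (1 / 2 : ℂ) * hT'
  · linear_combination e1
  · have hS : D 1 2 + D 2 1 = 0 := by linear_combination e12 - e1 - e2
    have hT : Complex.I * (D 1 2 - D 2 1) = 0 := by linear_combination e12i - e1 + Complex.I ^ 2 * e2
    have hT' : D 1 2 - D 2 1 = 0 := (mul_eq_zero.1 hT).resolve_left hI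
    linear_combination (1 / 2 : ℂ) * hS + (1 / 2 : ℂ) * hT'
  · have hS : D 0 2 + D 2 0 = 0 := by linear_combination e02 - e0 - e2
    have hT : Complex.I * (D 0 2 - D 2 0) = 0 := by linear_combination e02i - e0 + Complex.I ^ 2 * e2
    have hT' : D 0 2 - D 2 0 = 0 := (mul_eq_zero.1 hT).resolve_left hI
    linear_combination (1 / 2 : ℂ) * hS - (1 / 2 : ℂ) * hT'
  · have hS : D 1 2 + D 2 1 = 0 := by linear_combination e12 - e1 - e2
    have hT : Complex.I * (D 1 2 - D 2 1) = 0 := by linear_combination e12i - e1 + Complex.I ^ 2 * e2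
    have hT' : D 1 2 - D 2 1 = 0 := (mul_eq_zero.1 hT).resolve_left hI
    linear_combination (1 / 2 : ℂ) * hS - (1 / 2 : ℂ) * hT'
  · linear_combination e2

/-- Two matrices with the same sesquilinear form are equal (polarisation). -/
theorem matrix_eq_of_form_eq {B B' : Matrix (Fin 3) (Fin 3) ℂ}
    (h : ∀ y : Fin 3 → ℂ, star y ⬝ᵥ (B *ᵥ y) = star y ⬝ᵥ (B' *ᵥ y)) : B = B' := by
  have hq : ∀ y : Fin 3 → ℂ, star y ⬝ᵥ ((B - B') *ᵥ y) = 0 := by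
    intro y
    rw [Matrix.sub_mulVec, dotProduct_sub, h y, sub_self]
  exact sub_eq_zero.1 (matrix_eq_zero_of_form_eq_zero hq)

/-! ## 2. The origin, diagonal unitaries and the swap -/

/-- `lift3 0 = e₂`. -/
theorem lift3_zero : lift3 (0 : Fin 2 → ℂ) = ![0, 0, 1] := by
  ext i
  fin_cases i <;> rfl

/-- The origin is in the ball. -/
theorem zero_mem_ball : (0 : Fin 2 → ℂ) ∈ ball := by
  show nsq 0 < 1
  simp [nsq]

/-- `(y^* J y).re = |y₀|² + |y₁|² − |y₂|²`. -/
theorem jform_self_re (y : Fin 3 → ℂ) : (star y ⬝ᵥ (J *ᵥ y)).re = ‖y 0‖ ^ 2 + ‖y 1‖ ^ 2 - ‖y 2‖ ^ 2 := by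
  rw [jform_eq]
  simp only [Complex.sub_re, Complex.add_re, Complex.mul_re, Complex.conj_re, Complex.conj_im, Complex.sq_norm,
    Complex.normSq_apply]
  ring

/-- `maj y 0 = |y|²`. -/
theorem maj_zero (y : Fin 3 → ℂ) : maj y 0 = ‖y 0‖ ^ 2 + ‖y 1‖ ^ 2 + ‖y 2‖ ^ 2 := by
  unfold maj
  have h1 : star (lift3 (0 : Fin 2 → ℂ)) ⬝ᵥ (J *ᵥ y) = -(y 2) := by
    rw [jform_eq, lift3_zero]
    simp
  rw [jform_self_re, h1, norm_neg]
  simp [nsq]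
  ring

/-- The sesquilinear form at `M y` is the form of `Mᴴ A M` at `y`. -/
theorem form_conj (M A : Matrix (Fin 3) (Fin 3) ℂ) (y : Fin 3 → ℂ) :
    star (M *ᵥ y) ⬝ᵥ (A *ᵥ (M *ᵥ y)) = star y ⬝ᵥ ((Mᴴ * A * M) *ᵥ y) := by
  rw [Matrix.star_mulVec, Matrix.dotProduct_mulVec, ← Matrix.mulVec_mulVec, ← Matrix.mulVec_mulVec,
    ← Matrix.dotProduct_mulVec, ← Matrix.dotProduct_mulVec]

/-- **THE STABILISER IDENTITY AT THE ORIGIN.** For `M ∈ U(2,1)` fixing `0` with Jacobian matrix `P` at `0` and preserving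
`maj(·, 0)`, the equivariance gives the matrix identity `Σ_k P_{kl} · Mᴴ A_k(0) M = A_l(0)`. -/
theorem stab_identity (Φ : KMDatumS)
    (hequiv : ∀ M : Matrix (Fin 3) (Fin 3) ℂ, IsUnitaryOf (starRingAut : ℂ ≃+* ℂ) J M →
      ∀ (y : Fin 3 → ℂ) (z : Fin 2 → ℂ), z ∈ ball → ∀ l,
        (∑ k : Fin 2, datumS Φ (M *ᵥ y) (actM M z) k * pd l (fun w => actM M w k) z) = datumS Φ y z l)
    {M : Matrix (Fin 3) (Fin 3) ℂ} (hM : IsUnitaryOf (starRingAut : ℂ ≃+* ℂ) J M) (h0 : actM M 0 = 0)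
    (P : Fin 2 → Fin 2 → ℂ) (hP : ∀ k l, pd l (fun w => actM M w k) 0 = P k l)
    (hmaj : ∀ y, maj (M *ᵥ y) 0 = maj y 0) (l : Fin 2) :
    P 0 l • (Mᴴ * Φ.A 0 0 * M) + P 1 l • (Mᴴ * Φ.A 0 1 * M) = Φ.A 0 l := by
  apply matrix_eq_of_form_eq
  intro y
  have h := hequiv M hM y 0 zero_mem_ball l
  rw [h0, Fin.sum_univ_two, hP, hP] at h
  simp only [datumS, hmaj, form_conj] at h
  have hE : ((Real.exp (-Real.pi * maj y 0) : ℝ) : ℂ) ≠ 0 := by exact_mod_cast (Real.exp_pos _).ne'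
  have h' : (P 0 l * (star y ⬝ᵥ ((Mᴴ * Φ.A 0 0 * M) *ᵥ y)) + P 1 l * (star y ⬝ᵥ ((Mᴴ * Φ.A 0 1 * M) *ᵥ y))) *
      ((Real.exp (-Real.pi * maj y 0) : ℝ) : ℂ) = (star y ⬝ᵥ (Φ.A 0 l *ᵥ y)) * ((Real.exp (-Real.pi * maj y 0) : ℝ) : ℂ) := by
    linear_combination h
  rw [Matrix.add_mulVec, Matrix.smul_mulVec, Matrix.smul_mulVec, dotProduct_add, dotProduct_smul, dotProduct_smul,
    smul_eq_mul, smul_eq_mul]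
  exact mul_right_cancel₀ hE h'

/-! ### Diagonal unitaries `diag(d)`, `|d_i| = 1` -/

/-- A diagonal matrix with unimodular entries is in `U(2,1)`. -/
theorem isUnitary_diagonal {d : Fin 3 → ℂ} (hd : ∀ i, ‖d i‖ = 1) :
    IsUnitaryOf (starRingAut : ℂ ≃+* ℂ) J (Matrix.diagonal d) := by
  unfold IsUnitaryOf
  rw [cstar_starRingAut_eq, Matrix.diagonal_conjTranspose, J, Matrix.diagonal_mul_diagonal,
    Matrix.diagonal_mul_diagonal]
  congr 1
  ext i
  have hdi : star (d i) * d i = 1 := by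
    rw [Complex.star_def, Complex.conj_mul', hd i]
    simp
  simp only [Pi.star_apply]
  linear_combination (![(1 : ℂ), 1, -1] i) * hdi

/-- `diag(d)` fixes the origin. -/
theorem actM_diagonal_zero (d : Fin 3 → ℂ) : actM (Matrix.diagonal d) 0 = 0 := by
  ext k
  simp only [actM, lift3_zero, Matrix.mulVec_diagonal, Pi.zero_apply]
  fin_cases k <;> simp

/-- The Jacobian of `diag(d)` at the origin: `∂_l (diag(d) z)_k = d₂⁻¹ d_k δ_{kl}`. -/
theorem pd_actM_diagonal_zero {d : Fin 3 → ℂ} (hd2 : d 2 ≠ 0) (k l : Fin 2) :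
    pd l (fun w => actM (Matrix.diagonal d) w k) 0 = (d 2)⁻¹ * (if k = l then d (Fin.castSucc k) else 0) := by
  have hd : (Matrix.diagonal d *ᵥ lift3 0) 2 ≠ 0 := by
    rw [lift3_zero, Matrix.mulVec_diagonal]
    simpa using hd2
  rw [pd_actM_eq _ hd, lift3_zero]
  simp only [Matrix.mulVec_diagonal, Matrix.diagonal_apply, Fin.castSucc_inj]
  have h2 : (2 : Fin 3) ≠ Fin.castSucc l := by fin_cases l <;> decide
  have h3 : (![0, 0, 1] : Fin 3 → ℂ) (Fin.castSucc k) = 0 := by fin_cases k <;> rfl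
  rw [if_neg h2, h3]
  simp

/-- `diag(d)` with unimodular entries preserves `maj(·, 0) = |·|²`. -/
theorem maj_diagonal_mulVec_zero {d : Fin 3 → ℂ} (hd : ∀ i, ‖d i‖ = 1) (y : Fin 3 → ℂ) :
    maj (Matrix.diagonal d *ᵥ y) 0 = maj y 0 := by
  rw [maj_zero, maj_zero]
  simp [Matrix.mulVec_diagonal, hd]

/-- The entries of `diag(d)ᴴ A diag(d)`. -/
theorem diagonal_conj_apply (d : Fin 3 → ℂ) (A : Matrix (Fin 3) (Fin 3) ℂ) (i j : Fin 3) :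
    ((Matrix.diagonal d)ᴴ * A * Matrix.diagonal d) i j = star (d i) * A i j * d j := by
  rw [Matrix.diagonal_conjTranspose, Matrix.mul_diagonal, Matrix.diagonal_mul, Pi.star_apply]

/-! ### The swap of the first two coordinates -/

/-- The swap `(y₀, y₁, y₂) ↦ (y₁, y₀, y₂)`. -/
def swapMat : Matrix (Fin 3) (Fin 3) ℂ := !![0, 1, 0; 1, 0, 0; 0, 0, 1]

/-- `swapMat y = (y₁, y₀, y₂)`. -/
theorem swapMat_mulVec (y : Fin 3 → ℂ) : swapMat *ᵥ y = ![y 1, y 0, y 2] := by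
  ext i
  fin_cases i <;> simp [swapMat, Matrix.mulVec, dotProduct, Fin.sum_univ_three]

/-- The swap is in `U(2,1)`. -/
theorem isUnitary_swapMat : IsUnitaryOf (starRingAut : ℂ ≃+* ℂ) J swapMat := by
  unfold IsUnitaryOf
  rw [cstar_starRingAut_eq]
  ext i j
  fin_cases i <;> fin_cases j <;>
    simp [swapMat, J, Matrix.mul_apply, Fin.sum_univ_three, Matrix.conjTranspose_apply]

/-- The swap fixes the origin. -/
theorem actM_swapMat_zero : actM swapMat 0 = 0 := by
  ext k
  simp only [actM, lift3_zero, swapMat_mulVec, Pi.zero_apply]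
  fin_cases k <;> simp

/-- The Jacobian of the swap at the origin is the swap of `ℂ²`. -/
theorem pd_actM_swapMat_zero (k l : Fin 2) :
    pd l (fun w => actM swapMat w k) 0 = if k = l then 0 else 1 := by
  have hd : (swapMat *ᵥ lift3 0) 2 ≠ 0 := by
    rw [lift3_zero, swapMat_mulVec]
    simp
  rw [pd_actM_eq _ hd, lift3_zero, swapMat_mulVec]
  fin_cases k <;> fin_cases l <;> simp [swapMat]

/-- The swap preserves `maj(·, 0)`. -/
theorem maj_swapMat_mulVec_zero (y : Fin 3 → ℂ) : maj (swapMat *ᵥ y) 0 = maj y 0 := by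
  rw [maj_zero, maj_zero, swapMat_mulVec]
  simp
  ring

/-! ## 3. Rigidity at the origin -/

/-- If `a x = x` with `a ≠ 1` then `x = 0`. -/
theorem eq_zero_of_mul_eq_self {a x : ℂ} (ha : a ≠ 1) (h : a * x = x) : x = 0 := by
  have h' : (a - 1) * x = 0 := by linear_combination h
  exact (mul_eq_zero.1 h').resolve_left (sub_ne_zero.2 ha)

/-- The rotation `diag(1, 1, i)`. -/
def dI : Fin 3 → ℂ := ![1, 1, Complex.I]

/-- The reflection `diag(1, −1, 1)`. -/
def dN : Fin 3 → ℂ := ![1, -1, 1]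

/-- `dI` is `1` on the first two coordinates. -/
theorem dI_castSucc (k : Fin 2) : dI (Fin.castSucc k) = 1 := by fin_cases k <;> rfl

/-- `dI` is unimodular. -/
theorem dI_unimodular (i : Fin 3) : ‖dI i‖ = 1 := by fin_cases i <;> simp [dI]

/-- `dN` is unimodular. -/
theorem dN_unimodular (i : Fin 3) : ‖dN i‖ = 1 := by fin_cases i <;> simp [dN]

/-- (α) The rotation identity: `i⁻¹ · conj(dI_i) A_l(0)_{ij} dI_j = A_l(0)_{ij}`. -/
theorem rot_entry (Φ : KMDatumS)
    (hequiv : ∀ M : Matrix (Fin 3) (Fin 3) ℂ, IsUnitaryOf (starRingAut : ℂ ≃+* ℂ) J M →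
      ∀ (y : Fin 3 → ℂ) (z : Fin 2 → ℂ), z ∈ ball → ∀ l,
        (∑ k : Fin 2, datumS Φ (M *ᵥ y) (actM M z) k * pd l (fun w => actM M w k) z) = datumS Φ y z l)
    (l : Fin 2) (i j : Fin 3) :
    Complex.I⁻¹ * (star (dI i) * Φ.A 0 l i j * dI j) = Φ.A 0 l i j := by
  have hd2 : dI 2 ≠ 0 := by simp [dI]
  have h := stab_identity Φ hequiv (isUnitary_diagonal dI_unimodular) (actM_diagonal_zero dI) _
    (pd_actM_diagonal_zero hd2) (maj_diagonal_mulVec_zero dI_unimodular) l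
  have h' := congrFun (congrFun h i) j
  simp only [Matrix.add_apply, Matrix.smul_apply, diagonal_conj_apply, smul_eq_mul, dI_castSucc] at h'
  have hd2' : dI 2 = Complex.I := rfl
  rw [hd2'] at h'
  fin_cases l
  · show Complex.I⁻¹ * (star (dI i) * Φ.A 0 0 i j * dI j) = Φ.A 0 0 i j
    simp only [Fin.zero_eta, Fin.isValue, if_true, Fin.one_eq_zero_iff, OfNat.ofNat_ne_one, if_false,
      mul_zero, zero_mul, add_zero] at h'
    linear_combination h'
  · show Complex.I⁻¹ * (star (dI i) * Φ.A 0 1 i j * dI j) = Φ.A 0 1 i j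
    simp only [Fin.mk_one, Fin.isValue, Fin.zero_eq_one_iff, OfNat.ofNat_ne_one, if_false, if_true,
      mul_zero, zero_mul, zero_add] at h'
    linear_combination h'

/-- (α′) Every entry of `A_l(0)` outside the column `2`, and the entry `(2, 2)`, vanishes. -/
theorem origin_zero_of (Φ : KMDatumS)
    (hequiv : ∀ M : Matrix (Fin 3) (Fin 3) ℂ, IsUnitaryOf (starRingAut : ℂ ≃+* ℂ) J M →
      ∀ (y : Fin 3 → ℂ) (z : Fin 2 → ℂ), z ∈ ball → ∀ l,
        (∑ k : Fin 2, datumS Φ (M *ᵥ y) (actM M z) k * pd l (fun w => actM M w k) z) = datumS Φ y z l)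
    (l : Fin 2) (i j : Fin 3) (hij : j ≠ 2 ∨ i = 2) : Φ.A 0 l i j = 0 := by
  have h := rot_entry Φ hequiv l i j
  have h2 : (Complex.I⁻¹ * star (dI i) * dI j) * Φ.A 0 l i j = Φ.A 0 l i j := by linear_combination h
  refine eq_zero_of_mul_eq_self ?_ h2
  fin_cases i <;> fin_cases j <;> simp [dI, Complex.inv_I, Complex.ext_iff] at hij ⊢ <;> norm_num

/-- (β) The reflection `diag(1, −1, 1)`: the column-`2` entry of `A_l(0)` in the row of the OTHER slot vanishes. -/
theorem origin_offslot_zero (Φ : KMDatumS)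
    (hequiv : ∀ M : Matrix (Fin 3) (Fin 3) ℂ, IsUnitaryOf (starRingAut : ℂ ≃+* ℂ) J M →
      ∀ (y : Fin 3 → ℂ) (z : Fin 2 → ℂ), z ∈ ball → ∀ l,
        (∑ k : Fin 2, datumS Φ (M *ᵥ y) (actM M z) k * pd l (fun w => actM M w k) z) = datumS Φ y z l)
    (l i : Fin 2) (hil : i ≠ l) : Φ.A 0 l (Fin.castSucc i) 2 = 0 := by
  have hd2 : dN 2 ≠ 0 := by simp [dN]
  have h := stab_identity Φ hequiv (isUnitary_diagonal dN_unimodular) (actM_diagonal_zero dN) _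
    (pd_actM_diagonal_zero hd2) (maj_diagonal_mulVec_zero dN_unimodular) l
  have h' := congrFun (congrFun h (Fin.castSucc i)) 2
  simp only [Matrix.add_apply, Matrix.smul_apply, diagonal_conj_apply, smul_eq_mul] at h'
  fin_cases l <;> fin_cases i <;> simp [dN] at h' hil ⊢ <;>
    exact eq_zero_of_mul_eq_self (a := -1) (by norm_num) (by linear_combination h')

/-- (γ) The swap: `A_0(0)_{0,2} = A_1(0)_{1,2}`. -/
theorem origin_swap (Φ : KMDatumS)
    (hequiv : ∀ M : Matrix (Fin 3) (Fin 3) ℂ, IsUnitaryOf (starRingAut : ℂ ≃+* ℂ) J M →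
      ∀ (y : Fin 3 → ℂ) (z : Fin 2 → ℂ), z ∈ ball → ∀ l,
        (∑ k : Fin 2, datumS Φ (M *ᵥ y) (actM M z) k * pd l (fun w => actM M w k) z) = datumS Φ y z l) :
    Φ.A 0 0 0 2 = Φ.A 0 1 1 2 := by
  have h := stab_identity Φ hequiv isUnitary_swapMat actM_swapMat_zero _ pd_actM_swapMat_zero
    maj_swapMat_mulVec_zero 0
  have h' := congrFun (congrFun h 0) 2
  simp [swapMat, Matrix.mul_apply, Fin.sum_univ_three, Matrix.conjTranspose_apply] at h'
  exact h'.symm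

/-- **RIGIDITY AT THE ORIGIN.** For every datum with the equivariance of `ThetaData.equiv` there is one scalar `c` with
`A_k(0) = c · E_{k,2}`. -/
theorem origin_rigid (Φ : KMDatumS)
    (hequiv : ∀ M : Matrix (Fin 3) (Fin 3) ℂ, IsUnitaryOf (starRingAut : ℂ ≃+* ℂ) J M →
      ∀ (y : Fin 3 → ℂ) (z : Fin 2 → ℂ), z ∈ ball → ∀ l,
        (∑ k : Fin 2, datumS Φ (M *ᵥ y) (actM M z) k * pd l (fun w => actM M w k) z) = datumS Φ y z l) :
    ∃ c : ℂ, ∀ (k : Fin 2) (i j : Fin 3), Φ.A 0 k i j = if i = Fin.castSucc k ∧ j = 2 then c else 0 := by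
  refine ⟨Φ.A 0 0 0 2, fun k i j => ?_⟩
  by_cases hj : j = 2
  · subst hj
    fin_cases k <;> fin_cases i
    · rfl
    · exact origin_offslot_zero Φ hequiv 0 1 (by decide)
    · exact origin_zero_of Φ hequiv 0 2 2 (Or.inr rfl)
    · exact origin_offslot_zero Φ hequiv 1 0 (by decide)
    · exact (origin_swap Φ hequiv).symm
    · exact origin_zero_of Φ hequiv 1 2 2 (Or.inr rfl)
  · rw [if_neg fun h => hj h.2]
    exact origin_zero_of Φ hequiv k i j (Or.inl hj)

/-- The sesquilinear form at the origin: `y^* A_k(0) y = c · conj(y_k) y₂`. -/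
theorem origin_form (Φ : KMDatumS)
    (hequiv : ∀ M : Matrix (Fin 3) (Fin 3) ℂ, IsUnitaryOf (starRingAut : ℂ ≃+* ℂ) J M →
      ∀ (y : Fin 3 → ℂ) (z : Fin 2 → ℂ), z ∈ ball → ∀ l,
        (∑ k : Fin 2, datumS Φ (M *ᵥ y) (actM M z) k * pd l (fun w => actM M w k) z) = datumS Φ y z l) :
    ∃ c : ℂ, ∀ (k : Fin 2) (y : Fin 3 → ℂ),
      star y ⬝ᵥ (Φ.A 0 k *ᵥ y) = c * (conj (y (Fin.castSucc k)) * y 2) := by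
  obtain ⟨c, hc⟩ := origin_rigid Φ hequiv
  refine ⟨c, fun k y => ?_⟩
  simp only [dotProduct, Matrix.mulVec, Fin.sum_univ_three, hc, Pi.star_apply, Complex.star_def]
  fin_cases k <;> simp <;> ring

/-- **THE DATUM AT THE ORIGIN** of any equivariant datum is `c · conj(y_k) y₂ · e^{−π|y|²}`. -/
theorem datumS_zero_eq (Φ : KMDatumS)
    (hequiv : ∀ M : Matrix (Fin 3) (Fin 3) ℂ, IsUnitaryOf (starRingAut : ℂ ≃+* ℂ) J M →
      ∀ (y : Fin 3 → ℂ) (z : Fin 2 → ℂ), z ∈ ball → ∀ l,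
        (∑ k : Fin 2, datumS Φ (M *ᵥ y) (actM M z) k * pd l (fun w => actM M w k) z) = datumS Φ y z l) :
    ∃ c : ℂ, ∀ (k : Fin 2) (y : Fin 3 → ℂ), datumS Φ y 0 k =
      c * (conj (y (Fin.castSucc k)) * y 2) * ((Real.exp (-Real.pi * (‖y 0‖ ^ 2 + ‖y 1‖ ^ 2 + ‖y 2‖ ^ 2)) : ℝ) : ℂ) := by
  obtain ⟨c, hc⟩ := origin_form Φ hequiv
  exact ⟨c, fun k y => by rw [datumS, hc, maj_zero]⟩

namespace T4Data

/-- Rigidity at the origin for the datum of a `ThetaData`. -/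
theorem ThetaData.origin_rigid {X : T4Data} (D : X.ThetaData) :
    ∃ c : ℂ, ∀ (k : Fin 2) (i j : Fin 3), D.Φ.A 0 k i j = if i = Fin.castSucc k ∧ j = 2 then c else 0 :=
  Line3.origin_rigid D.Φ D.equiv

/-- The datum of a `ThetaData` at the origin is `c · conj(y_k) y₂ · e^{−π|y|²}`. -/
theorem ThetaData.datumS_zero_eq {X : T4Data} (D : X.ThetaData) :
    ∃ c : ℂ, ∀ (k : Fin 2) (y : Fin 3 → ℂ), datumS D.Φ y 0 k =
      c * (conj (y (Fin.castSucc k)) * y 2) * ((Real.exp (-Real.pi * (‖y 0‖ ^ 2 + ‖y 1‖ ^ 2 + ‖y 2‖ ^ 2)) : ℝ) : ℂ) :=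
  Line3.datumS_zero_eq D.Φ D.equiv

end T4Data

end Summit.Ventures.HodgeRepro.Tier4.Line3

end
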